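import Literature.MathematicalPhysics.QuantumLattice.TorusCooperSumFermiLevel
import HarnessLib

/-!
# Shell counting on the discrete torus: `#{k : |ε_L(k) - μ| ≤ η} ≤ √η·L² + 2L`

Topic `MathematicalPhysics/QuantumLattice`; companion of `TorusCooperSumFermiLevel.lean` (level counts near
the band EDGES) and of `TorusShellCounting.lean` (`card_torusShell_le`: the SHARP count `≲ ηL² + L` for
`μ` at distance `≥ d₀` from the critical values `{-4, 0, 4}`). Here the bound that is UNIFORM in the
level, at the price of the crude modulus `√η`:

* `two_mul_sq_div_pi_sq_le_abs_cos_sub_cos`: `2(a-b)²/π² ≤ |cos a - cos b|` on `[0, π]` (product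
  formula `cos a - cos b = -2 sin((a+b)/2) sin((a-b)/2)`, `sin((a+b)/2) ≥ sin(|a-b|/2)` there, and
  Jordan's inequality `sin t ≥ 2t/π`), hence `|cos a - cos b| ≤ η ⇒ |a - b| ≤ π√(η/2)`
  (`abs_sub_le_of_abs_cos_sub_cos_le`) — quantitative injectivity of `cos` on `[0, π]`, uniform up to
  the turning points;
* `card_filter_abs_cos_sub_le`: for every real `c` and `η`,
  `#{n ∈ ℤ/Lℤ : |cos(2πn/L) - c| ≤ η} ≤ √(2η)·L + 2` (fold `[0, 2π)` onto `[0, π]`, two integer windows);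
* `card_torusShell_le_sqrt`: for every level `μ` and width `η`,
  `#{k ∈ (ℤ/Lℤ)² : |torusBand L k - μ| ≤ η} ≤ √η · L² + 2L` (row by row), uniformly in `μ` —
  including the van Hove level `μ = 0` and the band edges `μ = ±4`, where the sharp counts are
  `η log(1/η) L²` and `η^{1/2}`-free respectively; the crude `√η` modulus is what makes the bound
  uniform and is all that "the shell has vanishing density as `η → 0`" arguments need.

Requested by the standing disprover of crux `WcbcsBcsConstruction` (route
`HubbardSuperconductivity/WeakCouplingBCS`) for the free-gas anchor `dWaveOrderParameter 0 μ = 0`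
(the sourced free Fermi gas gains only `o(h)·L²` energy from a pair source `h`); usable by the
Cooper-logarithm UPPER bounds of the routes `TorusCooperLog` / `LogColdTorus` (support item
`WcbcsSourcedFreeGasCooperLog`). Sources: elementary; S. Friedli, Y. Velenik (2017) §10.4 for the
momentum grid. No named facts, no definitions. Tree search: `lean search
"abs_cos_sub_cos_arccos|card_filter_abs_cos"` — nothing; nearest `card_torusShell_le`
(`TorusShellCounting`, non-uniform in `μ`), `card_filter_cos_ge_le` (`TorusCooperSumFermiLevel`).
-/

noncomputable section

namespace Literature.MathematicalPhysics.QuantumLattice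

open Real Finset Literature.Probability.LatticeModels

section Trig

/-- **Quantitative injectivity of `cos` on `[0, π]`**: `2(a - b)²/π² ≤ |cos a - cos b|` for
`a, b ∈ [0, π]` (product formula and Jordan's inequality). [folklore] -/
theorem two_mul_sq_div_pi_sq_le_abs_cos_sub_cos {a b : ℝ} (ha0 : 0 ≤ a) (haπ : a ≤ π)
    (hb0 : 0 ≤ b) (hbπ : b ≤ π) : 2 * (a - b) ^ 2 / π ^ 2 ≤ |Real.cos a - Real.cos b| := by
  have hπ := Real.pi_pos
  -- reduce to `a ≥ b` by symmetry
  wlog hab : b ≤ a generalizing a b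
  · have h := this hb0 hbπ ha0 haπ (le_of_not_ge hab)
    rwa [abs_sub_comm, show (b - a) ^ 2 = (a - b) ^ 2 by ring] at h
  set s : ℝ := (a + b) / 2 with hs
  set t : ℝ := (a - b) / 2 with ht
  have ht0 : 0 ≤ t := by rw [ht]; linarith
  have htπ : t ≤ π / 2 := by rw [ht]; linarith
  have hst : t ≤ s := by rw [hs, ht]; linarith
  have hst' : s + t ≤ π := by rw [hs, ht]; linarith
  have hcos : Real.cos a - Real.cos b = -2 * Real.sin s * Real.sin t := by
    rw [Real.cos_sub_cos]
  -- `sin s ≥ sin t ≥ 0`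
  have hsin_t : 0 ≤ Real.sin t := Real.sin_nonneg_of_nonneg_of_le_pi ht0 (by linarith)
  have hsin_s : Real.sin t ≤ Real.sin s := by
    have h := Real.sin_sub_sin s t
    have h1 : 0 ≤ Real.sin ((s - t) / 2) :=
      Real.sin_nonneg_of_nonneg_of_le_pi (by linarith) (by linarith)
    have h2 : 0 ≤ Real.cos ((s + t) / 2) :=
      Real.cos_nonneg_of_mem_Icc ⟨by linarith, by linarith⟩
    nlinarith [mul_nonneg h1 h2]
  -- Jordan: `2t/π ≤ sin t`
  have hjordan : 2 / π * t ≤ Real.sin t := Real.mul_le_sin ht0 htπ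
  have habs : |Real.cos a - Real.cos b| = 2 * Real.sin s * Real.sin t := by
    rw [hcos, show -2 * Real.sin s * Real.sin t = -(2 * Real.sin s * Real.sin t) by ring, abs_neg,
      abs_of_nonneg]
    exact mul_nonneg (mul_nonneg zero_le_two (hsin_t.trans hsin_s)) hsin_t
  rw [habs]
  have h2t : 0 ≤ 2 / π * t := by positivity
  calc 2 * (a - b) ^ 2 / π ^ 2 = 2 * (2 / π * t) * (2 / π * t) := by
        rw [ht]; field_simp
    _ ≤ 2 * Real.sin t * Real.sin t := by gcongr
    _ ≤ 2 * Real.sin s * Real.sin t := by gcongr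

/-- Hence `|cos a - cos b| ≤ η` on `[0, π]` forces `|a - b| ≤ π √(η/2)`. [folklore] -/
theorem abs_sub_le_of_abs_cos_sub_cos_le {a b η : ℝ} (ha0 : 0 ≤ a) (haπ : a ≤ π) (hb0 : 0 ≤ b)
    (hbπ : b ≤ π) (h : |Real.cos a - Real.cos b| ≤ η) : |a - b| ≤ π * Real.sqrt (η / 2) := by
  have hπ := Real.pi_pos
  have h1 := (two_mul_sq_div_pi_sq_le_abs_cos_sub_cos ha0 haπ hb0 hbπ).trans h
  have h2 : (a - b) ^ 2 ≤ (π * Real.sqrt (η / 2)) ^ 2 := by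
    have hη : 0 ≤ η := (abs_nonneg _).trans h
    rw [mul_pow, Real.sq_sqrt (by positivity)]
    rw [div_le_iff₀ (by positivity)] at h1
    nlinarith
  exact abs_le_of_sq_le_sq h2 (by positivity)

/-- Replacing the level `c` by `cos (arccos c)` (`= c` clamped to `[-1, 1]`) never increases the
distance to a cosine: `|cos x - cos (arccos c)| ≤ |cos x - c|`. [folklore] -/
theorem abs_cos_sub_cos_arccos_le (x c : ℝ) :
    |Real.cos x - Real.cos (Real.arccos c)| ≤ |Real.cos x - c| := by
  rcases le_total c (-1) with hc | hc
  · rw [Real.arccos_of_le_neg_one hc, Real.cos_pi]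
    have h1 := Real.neg_one_le_cos x
    rw [abs_of_nonneg (by linarith), abs_of_nonneg (by linarith)]
    linarith
  rcases le_total 1 c with hc' | hc'
  · rw [Real.arccos_of_one_le hc', Real.cos_zero]
    have h1 := Real.cos_le_one x
    rw [abs_of_nonpos (by linarith), abs_of_nonpos (by linarith)]
    linarith
  · rw [Real.cos_arccos hc hc']

end Trig

section OneDim

variable {L : ℕ} [NeZero L]

/-- **Momenta of `ℤ/Lℤ` whose cosine lies in an interval of length `2η`**: for every `c ∈ ℝ` and
`η` (for `η < 0` the set is empty), `#{n : |cos(2πn/L) - c| ≤ η} ≤ √(2η)·L + 2` (two arcs of angular half-width `π√(η/2)`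
around `±arccos c`, each holding at most `√(η/2) L + 1` grid points). [folklore] -/
theorem card_filter_abs_cos_sub_le (c η : ℝ) :
    ((univ.filter fun n : ZMod L => |Real.cos (2 * π * n.val / L) - c| ≤ η).card : ℝ) ≤
      Real.sqrt (2 * η) * L + 2 := by
  classical
  have hπ := Real.pi_pos
  have hL : 0 < L := Nat.pos_of_ne_zero (NeZero.ne L)
  have hLr : (0 : ℝ) < L := by exact_mod_cast hL
  set θ₀ : ℝ := Real.arccos c with hθ₀
  have hθ₀0 : 0 ≤ θ₀ := Real.arccos_nonneg c
  have hθ₀π : θ₀ ≤ π := Real.arccos_le_pi c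
  set ρ : ℝ := π * Real.sqrt (η / 2) with hρ
  have hρ0 : 0 ≤ ρ := by positivity
  set M : ℕ := ⌊ρ * L / π⌋₊ with hM
  set c₀ : ℕ := ⌈(θ₀ - ρ) * L / (2 * π)⌉₊ with hc₀
  set c₁ : ℕ := ⌈(L : ℝ) - (θ₀ + ρ) * L / (2 * π)⌉₊ with hc₁
  set A : Finset (ZMod L) := (range (M + 1)).image fun j : ℕ => ((c₀ + j : ℕ) : ZMod L) with hA
  set B : Finset (ZMod L) := (range (M + 1)).image fun j : ℕ => ((c₁ + j : ℕ) : ZMod L) with hB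
  -- membership in an integer window from real bounds
  have hwindow : ∀ (cst : ℕ) (lo : ℝ) (v : ℕ), cst = ⌈lo⌉₊ → lo ≤ v → (v : ℝ) ≤ lo + ρ * L / π →
      ((v : ℕ) : ZMod L) ∈ (range (M + 1)).image fun j : ℕ => ((cst + j : ℕ) : ZMod L) := by
    intro cst lo v hcst hlo hhi
    have hcv : cst ≤ v := by
      rw [hcst]
      exact Nat.ceil_le.2 hlo
    have hcst_ge : lo ≤ cst := by rw [hcst]; exact Nat.le_ceil lo
    rw [mem_image]
    refine ⟨v - cst, ?_, ?_⟩
    · rw [mem_range, Nat.lt_add_one_iff, hM]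
      refine Nat.le_floor ?_
      rw [Nat.cast_sub hcv]
      linarith
    · congr 1
      omega
  have hsub : (univ.filter fun n : ZMod L => |Real.cos (2 * π * n.val / L) - c| ≤ η) ⊆ A ∪ B := by
    intro n hn
    rw [mem_filter] at hn
    have hv : n.val < L := ZMod.val_lt n
    have hvr : (n.val : ℝ) < L := by exact_mod_cast hv
    set x : ℝ := 2 * π * n.val / L with hx
    have hx0 : 0 ≤ x := by positivity
    have hx2π : x ≤ 2 * π := by
      rw [hx, div_le_iff₀ hLr]; nlinarith
    have hcx : |Real.cos x - Real.cos θ₀| ≤ η := (abs_cos_sub_cos_arccos_le x c).trans hn.2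
    rw [mem_union]
    have hn_eq : ((n.val : ℕ) : ZMod L) = n := ZMod.natCast_zmod_val n
    by_cases hxπ : x ≤ π
    · -- branch `x ∈ [0, π]`: `|x - θ₀| ≤ ρ`
      left
      have hd := abs_sub_le_of_abs_cos_sub_cos_le hx0 hxπ hθ₀0 hθ₀π hcx
      rw [abs_le] at hd
      rw [← hn_eq, hA]
      refine hwindow c₀ ((θ₀ - ρ) * L / (2 * π)) n.val hc₀ ?_ ?_
      · rw [div_le_iff₀ (by positivity)]
        have : x * L = 2 * π * n.val := by rw [hx]; field_simp
        nlinarith [hd.1]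
      · have h1 : (θ₀ - ρ) * L / (2 * π) + ρ * L / π = (θ₀ + ρ) * L / (2 * π) := by
          field_simp; ring
        rw [h1, le_div_iff₀ (by positivity)]
        have : x * L = 2 * π * n.val := by rw [hx]; field_simp
        nlinarith [hd.2]
    · -- branch `x ∈ (π, 2π]`: fold to `2π - x ∈ [0, π)`
      right
      push Not at hxπ
      have hcx' : |Real.cos (2 * π - x) - Real.cos θ₀| ≤ η := by rwa [Real.cos_two_pi_sub]
      have hd := abs_sub_le_of_abs_cos_sub_cos_le (by linarith) (by linarith) hθ₀0 hθ₀π hcx'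
      rw [abs_le] at hd
      rw [← hn_eq, hB]
      refine hwindow c₁ ((L : ℝ) - (θ₀ + ρ) * L / (2 * π)) n.val hc₁ ?_ ?_
      · have hxL : x * L = 2 * π * n.val := by rw [hx]; field_simp
        have key : (2 * π - θ₀ - ρ) * L ≤ 2 * π * n.val := by
          rw [← hxL]
          exact mul_le_mul_of_nonneg_right (by linarith [hd.2]) hLr.le
        have e : (L : ℝ) - (θ₀ + ρ) * L / (2 * π) = (2 * π - θ₀ - ρ) * L / (2 * π) := by
          field_simp; ring
        rw [e, div_le_iff₀ (by positivity)]
        linarith [key]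
      · have h1 : (L : ℝ) - (θ₀ + ρ) * L / (2 * π) + ρ * L / π = (2 * π - θ₀ + ρ) * L / (2 * π) := by
          field_simp; ring
        have hxL : x * L = 2 * π * n.val := by rw [hx]; field_simp
        have key : 2 * π * n.val ≤ (2 * π - θ₀ + ρ) * L := by
          rw [← hxL]
          exact mul_le_mul_of_nonneg_right (by linarith [hd.1]) hLr.le
        rw [h1, le_div_iff₀ (by positivity)]
        linarith [key]
  calc ((univ.filter fun n : ZMod L => |Real.cos (2 * π * n.val / L) - c| ≤ η).card : ℝ)
      ≤ ((A ∪ B).card : ℝ) := by exact_mod_cast card_le_card hsub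
    _ ≤ (A.card : ℝ) + B.card := by exact_mod_cast card_union_le A B
    _ ≤ (M + 1 : ℝ) + (M + 1) := by
        gcongr
        · exact_mod_cast (card_image_le.trans (card_range _).le)
        · exact_mod_cast (card_image_le.trans (card_range _).le)
    _ ≤ Real.sqrt (2 * η) * L + 2 := by
        have hM' : (M : ℝ) ≤ ρ * L / π := Nat.floor_le (by positivity)
        have hρπ : ρ / π = Real.sqrt (η / 2) := by rw [hρ]; field_simp
        have hsq : 2 * Real.sqrt (η / 2) = Real.sqrt (2 * η) := by
          rw [show (2 : ℝ) * η = 2 ^ 2 * (η / 2) by ring, Real.sqrt_mul (by norm_num), Real.sqrt_sq zero_le_two]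
        have : 2 * (ρ * L / π) = Real.sqrt (2 * η) * L := by
          rw [← hsq, ← hρπ]; ring
        linarith

end OneDim

section TwoDim

variable {L : ℕ} [NeZero L]

/-- **Shell counting on the two-dimensional torus**: for every level `μ` and width `η`,
`#{k ∈ (ℤ/Lℤ)² : |ε_L(k) - μ| ≤ η} ≤ √η · L² + 2L`, `ε_L(k) = -2(cos(2πk₁/L) + cos(2πk₂/L))`
(`torusBand`): row by row, `|cos(2πk₁/L) - c(k₂)| ≤ η/2` with `c(k₂) = -(μ + 2cos(2πk₂/L))/2`, and
each row holds at most `√η L + 2` such momenta (`card_filter_abs_cos_sub_le`). Uniform in `μ`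
(including the van Hove level `μ = 0` and the band edges). [folklore] -/
theorem card_torusShell_le_sqrt (μ η : ℝ) :
    ((univ.filter fun k : TorusSite 2 L => |torusBand L k - μ| ≤ η).card : ℝ) ≤
      Real.sqrt η * (L : ℝ) ^ 2 + 2 * L := by
  classical
  -- rewrite the condition row-wise
  have hcond : ∀ k : TorusSite 2 L, |torusBand L k - μ| ≤ η ↔
      |Real.cos (2 * π * (k 0).val / L) - (-(μ + 2 * Real.cos (2 * π * (k 1).val / L)) / 2)| ≤ η / 2 := by
    intro k
    unfold torusBand
    rw [Fin.sum_univ_two]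
    simp only [latticeMomentum]
    have : -2 * (Real.cos (2 * π * ((k 0).val : ℝ) / L) + Real.cos (2 * π * ((k 1).val : ℝ) / L)) - μ =
        -2 * (Real.cos (2 * π * ((k 0).val : ℝ) / L) - (-(μ + 2 * Real.cos (2 * π * ((k 1).val : ℝ) / L)) / 2)) := by
      ring
    rw [this, abs_mul, abs_neg, abs_two]
    constructor
    · intro h; linarith
    · intro h; linarith
  -- count fiberwise over the second coordinate
  have hcard : ((univ.filter fun k : TorusSite 2 L => |torusBand L k - μ| ≤ η).card : ℝ) =
      ∑ b : ZMod L, (((univ.filter fun a : ZMod L =>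
        |Real.cos (2 * π * a.val / L) - (-(μ + 2 * Real.cos (2 * π * b.val / L)) / 2)| ≤ η / 2).card : ℕ) : ℝ) := by
    rw [← Nat.cast_sum]
    congr 1
    rw [card_eq_sum_ones, Finset.sum_filter]
    rw [← (piFinTwoEquiv fun _ : Fin 2 => ZMod L).symm.sum_comp]
    rw [Fintype.sum_prod_type]
    rw [Finset.sum_comm]
    refine Finset.sum_congr rfl fun b _ => ?_
    rw [card_eq_sum_ones, Finset.sum_filter]
    refine Finset.sum_congr rfl fun a _ => ?_
    simp only [piFinTwoEquiv_symm_apply, hcond]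
    rfl
  rw [hcard]
  have hrow : ∀ b : ZMod L, (((univ.filter fun a : ZMod L =>
        |Real.cos (2 * π * a.val / L) - (-(μ + 2 * Real.cos (2 * π * b.val / L)) / 2)| ≤ η / 2).card : ℕ) : ℝ) ≤
      Real.sqrt η * L + 2 := by
    intro b
    have h := card_filter_abs_cos_sub_le (L := L) (-(μ + 2 * Real.cos (2 * π * b.val / L)) / 2) (η / 2)
    rw [show 2 * (η / 2) = η by ring] at h
    exact h
  calc ∑ b : ZMod L, (((univ.filter fun a : ZMod L =>
        |Real.cos (2 * π * a.val / L) - (-(μ + 2 * Real.cos (2 * π * b.val / L)) / 2)| ≤ η / 2).card : ℕ) : ℝ)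
      ≤ ∑ _b : ZMod L, (Real.sqrt η * L + 2) := Finset.sum_le_sum fun b _ => hrow b
    _ = Real.sqrt η * (L : ℝ) ^ 2 + 2 * L := by
        rw [Finset.sum_const, Finset.card_univ, ZMod.card, nsmul_eq_mul]
        ring

end TwoDim

end Literature.MathematicalPhysics.QuantumLattice

end
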